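import Summits.QuantumFields.YangMills.Theorems.UnitScaleTiltProp7LemmaHCurvedOfLocalModels
import Summits.QuantumFields.YangMills.Theorems.UnitScaleTiltProp7AxialLocalModel
import HarnessLib

/-!
# Route `UnitScaleTilt`, crux K1 «MinimiserStabilityRegPr» (stmt-QuantumFields-19200), route-R E′ path (α′), S3 K-form engine, row (R4′) — FILE 9g:
# AVERAGED LOCAL MODELS — the blend of an AVERAGE `Ψ̄_y = |H|⁻¹Σ_η Ψ^η_y` of local-model families costs at most the AVERAGE of the families' covariant energies
# (convexity), so ✓ `lemmaH_curved_of_localModels` may be fed a family of axial models with DIFFERENT bases per centre (the comb-averaging cure of the trunk-plane multiplicity,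
# LOCATE v1.1 §4 (c3)); T³ instance in loop-commutator currency = ✓ `lemmaH_curved_comb` (F-H9f) averaged over bases

Cell `ym3-torus`, D-0154 (3c) twin-width seat `ym-routeR-w1` (gen 6); row (R4′) «framed-constant models in commutator currency» (namer ★ym-ust-19200-p1 g15; S3-CURVED verdict
2026-08-28 21:04Z; standing PASS reaffirmed 21:15Z; LOCATE v1.1 = 19200 evidence #52; px17 g2's (c3) cross-check 21:02Z = the cure typed here in its abstract form).  THEOREMS ONLY
(0 `def`, 0 `sorry`); `--supports stmt-QuantumFields-19200`, count-neutral.  YM₃ on T³ is a ladder rung (R3), not the Clay problem; nothing here claims a stub, the crux, d = 4 or the mass gap.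

WHAT (ns `…Theorems.Prop7LocalModelAverage`).
* §1 (abstract carrier of ✓ `Prop7LocalModelBlend`; `H` a finite nonempty index type, weights `|H|⁻¹`): `covD_avg`, `covDstar_avg`, `lap_avg` (ℝ-linearity of `D_U`, `D*_U`, `Δ_U`
  over the average), `norm_sq_avg_le` (`‖|H|⁻¹Σ_η a_η‖² ≤ |H|⁻¹Σ_η‖a_η‖²`), hence ★ `norm_sq_covD_avg_le` ∕ `norm_sq_covDstar_avg_le` ∕ `norm_sq_lap_avg_le`.
* §2 ★★★ `lemmaH_curved_of_localModels_avg` (T³ letters): for families `Ψ : H → (centres → sites → M₂)` each interpolating `ψ` at the centres and a data row for the AVERAGE `Ψ̄`,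
  `L^(K−n)·Σ‖Δ_Wψ‖²_HS ≤ L^(K−n)·2·{ 3·Σ_yΣ_{z:N y z}|H|⁻¹Σ_η‖Δ_WΨ^η_y(z)‖² + 3(2d·6∕ℓ)(3∕ℓ)·Σ_yΣ_{z:N y z}Σ_μ|H|⁻¹Σ_η(‖D*_WΨ^η_y‖² + ‖D_WΨ^η_y‖²) + 3d²(24∕ℓ²)((24∕ℓ²)ℓ^d)Σ_yG_y² }`.
* §3 ★★★ `lemmaH_curved_comb_avg`: the same at AXIAL families `Ψ^η_y(z) = R((axialT W (c^η_y) z)⁻¹) m^η_y` with bases `c^η_y` and data `m^η_y` subject to the displayed interpolation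
  `R((axialT W c^η_y (embIter y))⁻¹) m^η_y = ψ(embIter y)` (inhabited by `c^η_y = c_y + η·e`, `m^η_y = R(W(straight segment)⁻¹)ψ(c_y)`) and no-wrap rows: both slack groups become
  AVERAGES over `η` of the loop-commutator sums of ✓ `lemmaH_curved_comb` with loops based at `c^η_y` and `N_{m^η_y}` — every term still a commutator (zero on aligned data).
HONEST SCOPE.  Convexity + composition; the choice of bases, the counts and the booking are the next file ∕ the call site; nothing of Bałaban's asserted; no stub∕crux∕rung statement.

References: T. Bałaban, CMP 99 (1985) 389–434 [Balaban1985BackgroundPropagators] ((3.3)-(3.4) pp.390-391, Thm 3.11 p.416); CMP 102 (1985) 255–275 [Balaban1985UV3] ((27) p.263);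
CMP 98 (1985) 17–51 [Balaban1985Averaging] ((9) p.19, p.24); CMP 102 (1985) 277–309 [Balaban1985Variational] (Prop. 7 p.299).
-/

set_option autoImplicit false

noncomputable section

open scoped BigOperators Matrix.Norms.L2Operator Matrix

namespace Summit.QuantumFields.YangMills.Theorems.Prop7LocalModelAverage

open Literature.MathematicalPhysics.QuantumFieldTheory.Balaban1983to89
open Literature.MathematicalPhysics.QuantumFieldTheory.Balaban1983to89.T3ContinuumYM3Torus
open B9Eq39Adjoint (R covD covDstar divB)
open B9TorusCalculus (torusT)
open B10Eq27TorusAxialLog (unitsField toUField holT axialT contourT rel)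
open B5Eq118OneStroke (iterBlockOf)
open B15DeterminingSets (embIter)
open Summit.QuantumFields.YangMills.Theorems.Prop7HermiteCornerBlendCov (covD_finset_sum covDstar_finset_sum divB_covD_finset_sum)
open Summit.QuantumFields.YangMills.Theorems.Prop7ConjFrameTransport (covD_smul_fun covDstar_smul_fun divB_covD_smul_fun)
open Summit.QuantumFields.YangMills.Theorems.Prop7HermiteCornerBlendEnergy (jensen_sq)
open Summit.QuantumFields.YangMills.Theorems.Prop7CovHodgeSplit (unitsField_toUField_mem_unitary)
open Summit.QuantumFields.YangMills.Theorems.Prop7LemmaHCurvedOfRows (bicontr_of_mem_unitary)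
open Summit.QuantumFields.YangMills.Theorems.Prop7LemmaHCurvedOfLocalModels (lemmaH_curved_of_localModels)
open Summit.QuantumFields.YangMills.Theorems.Prop7AxialLocalModel (norm_covD_axialModel_le norm_covDstar_axialModel_le norm_lap_axialModel_le)

/-! ## §1 Averages of local models: linearity and convexity -/

section Abstract

variable {𝔸 : Type*} [NormedRing 𝔸] [NormedAlgebra ℝ 𝔸] {S : Type*} {ι : Type*} [Fintype ι] (T : ι → Equiv.Perm S) (U : ι → S → 𝔸ˣ)
  {H : Type*} [Fintype H]

omit [Fintype ι] in
/-- `D_U` of an average is the average of the `D_U`'s. [cite: Balaban1985BackgroundPropagators, (3.3) p.390] -/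
theorem covD_avg (Φ : H → S → 𝔸) (μ : ι) (x : S) :
    covD T U μ (fun z => (Fintype.card H : ℝ)⁻¹ • ∑ η, Φ η z) x = (Fintype.card H : ℝ)⁻¹ • ∑ η, covD T U μ (Φ η) x := by
  rw [covD_smul_fun T U (fun _ => (Fintype.card H : ℝ)⁻¹) (fun z => ∑ η, Φ η z) μ x, sub_self, zero_smul, add_zero,
    covD_finset_sum T U Finset.univ Φ μ x]

omit [Fintype ι] in
/-- `D*_U` of an average is the average of the `D*_U`'s. [cite: Balaban1985BackgroundPropagators, (3.8) p.392] -/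
theorem covDstar_avg (Φ : H → S → 𝔸) (μ : ι) (x : S) :
    covDstar T U μ (fun z => (Fintype.card H : ℝ)⁻¹ • ∑ η, Φ η z) x = (Fintype.card H : ℝ)⁻¹ • ∑ η, covDstar T U μ (Φ η) x := by
  rw [covDstar_smul_fun T U (fun _ => (Fintype.card H : ℝ)⁻¹) (fun z => ∑ η, Φ η z) μ x, sub_self, zero_smul, add_zero,
    covDstar_finset_sum T U Finset.univ Φ μ x]

/-- `Δ_U` of an average is the average of the `Δ_U`'s. [cite: Balaban1985BackgroundPropagators, (3.3) p.390, (3.8) p.392] -/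
theorem lap_avg (Φ : H → S → 𝔸) (x : S) :
    divB T U (fun μ => covD T U μ (fun z => (Fintype.card H : ℝ)⁻¹ • ∑ η, Φ η z)) x = (Fintype.card H : ℝ)⁻¹ • ∑ η, divB T U (fun μ => covD T U μ (Φ η)) x := by
  rw [divB_covD_smul_fun T U (fun _ => (Fintype.card H : ℝ)⁻¹) (fun z => ∑ η, Φ η z) x]
  simp only [sub_self, zero_smul, Finset.sum_const_zero, add_zero]
  rw [divB_covD_finset_sum T U Finset.univ Φ x]

omit [Fintype ι] in
/-- convexity of the square of the norm over an average: `‖|H|⁻¹Σ_η a_η‖² ≤ |H|⁻¹Σ_η ‖a_η‖²` (`H` nonempty). [folklore] -/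
theorem norm_sq_avg_le [Nonempty H] (a : H → 𝔸) :
    ‖(Fintype.card H : ℝ)⁻¹ • ∑ η, a η‖ ^ 2 ≤ (Fintype.card H : ℝ)⁻¹ * ∑ η, ‖a η‖ ^ 2 := by
  have hc : (0 : ℝ) < Fintype.card H := by exact_mod_cast Fintype.card_pos
  have h1 : ‖(Fintype.card H : ℝ)⁻¹ • ∑ η, a η‖ ≤ ∑ η, (Fintype.card H : ℝ)⁻¹ * ‖a η‖ := by
    rw [norm_smul, Real.norm_eq_abs, abs_of_pos (inv_pos.mpr hc), ← Finset.mul_sum]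
    exact mul_le_mul_of_nonneg_left (norm_sum_le _ _) (inv_pos.mpr hc).le
  have hJ := jensen_sq (fun _ : H => (Fintype.card H : ℝ)⁻¹) (fun η => ‖a η‖) (fun _ => (inv_pos.mpr hc).le)
    (by rw [Finset.sum_const, Finset.card_univ, nsmul_eq_mul, mul_inv_cancel₀ hc.ne'])
  calc ‖(Fintype.card H : ℝ)⁻¹ • ∑ η, a η‖ ^ 2 ≤ (∑ η, (Fintype.card H : ℝ)⁻¹ * ‖a η‖) ^ 2 := pow_le_pow_left₀ (norm_nonneg _) h1 2
    _ ≤ ∑ η, (Fintype.card H : ℝ)⁻¹ * ‖a η‖ ^ 2 := hJ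
    _ = (Fintype.card H : ℝ)⁻¹ * ∑ η, ‖a η‖ ^ 2 := by rw [Finset.mul_sum]

omit [Fintype ι] in
/-- ★ `‖D_U Ψ̄(x,μ)‖² ≤ |H|⁻¹Σ_η ‖D_U Ψ^η(x,μ)‖²`. [cite: Balaban1985BackgroundPropagators, (3.3) p.390] -/
theorem norm_sq_covD_avg_le [Nonempty H] (Φ : H → S → 𝔸) (μ : ι) (x : S) :
    ‖covD T U μ (fun z => (Fintype.card H : ℝ)⁻¹ • ∑ η, Φ η z) x‖ ^ 2 ≤ (Fintype.card H : ℝ)⁻¹ * ∑ η, ‖covD T U μ (Φ η) x‖ ^ 2 := by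
  rw [covD_avg]; exact norm_sq_avg_le _

omit [Fintype ι] in
/-- `‖D*_U Ψ̄(x,μ)‖² ≤ |H|⁻¹Σ_η ‖D*_U Ψ^η(x,μ)‖²`. [cite: Balaban1985BackgroundPropagators, (3.8) p.392] -/
theorem norm_sq_covDstar_avg_le [Nonempty H] (Φ : H → S → 𝔸) (μ : ι) (x : S) :
    ‖covDstar T U μ (fun z => (Fintype.card H : ℝ)⁻¹ • ∑ η, Φ η z) x‖ ^ 2 ≤ (Fintype.card H : ℝ)⁻¹ * ∑ η, ‖covDstar T U μ (Φ η) x‖ ^ 2 := by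
  rw [covDstar_avg]; exact norm_sq_avg_le _

/-- ★ `‖Δ_U Ψ̄(x)‖² ≤ |H|⁻¹Σ_η ‖Δ_U Ψ^η(x)‖²`. [cite: Balaban1985BackgroundPropagators, (3.3) p.390, (3.8) p.392] -/
theorem norm_sq_lap_avg_le [Nonempty H] (Φ : H → S → 𝔸) (x : S) :
    ‖divB T U (fun μ => covD T U μ (fun z => (Fintype.card H : ℝ)⁻¹ • ∑ η, Φ η z)) x‖ ^ 2 ≤ (Fintype.card H : ℝ)⁻¹ * ∑ η, ‖divB T U (fun μ => covD T U μ (Φ η)) x‖ ^ 2 := by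
  rw [lap_avg]; exact norm_sq_avg_le _

end Abstract

/-! ## §2 LEMMA-H-curved with an AVERAGED family of local models (T³ letters) -/

section T3

variable {H : Type*} [Fintype H] [Nonempty H]

/-- ★★★ **LEMMA-H-CURVED, AVERAGED LOCAL MODELS**: for families `Ψ^η` (`η ∈ H`) each interpolating `ψ` at the centres, the blend of the average `Ψ̄` gives the bound of
✓ `lemmaH_curved_of_localModels` with both slack groups replaced by AVERAGES over `η` of the families' energies (convexity), and the data row stated for `Ψ̄`.
[cite: Balaban1985BackgroundPropagators, (3.3)-(3.4) pp.390-391, Thm 3.11 p.416; Balaban1984PropagatorsI, (1.29)-(1.31) p.23; Balaban1985Variational, Prop. 7 p.299] -/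
theorem lemmaH_curved_of_localModels_avg (F : T3Family) (K n : ℕ) (hk : K - n ≤ (F.P K).m + (F.P K).K) (hℓ2 : 2 ≤ (F.P K).L ^ (K - n))
    (W : GaugeField (F.P K) 0 (Matrix.specialUnitaryGroup (Fin 2) ℂ)) (ψ : Site (F.P K) 0 → Matrix (Fin 2) (Fin 2) ℂ)
    (hψ : ∀ x : Site (F.P K) 0, x ∉ Set.range (embIter (K - n)) →
      divB (torusT (F.P K) 0) (fun κ z => unitsField (toUField W) ⟨z, κ⟩) (fun κ y => covD (torusT (F.P K) 0) (fun κ z => unitsField (toUField W) ⟨z, κ⟩) κ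
        (fun z => divB (torusT (F.P K) 0) (fun κ z => unitsField (toUField W) ⟨z, κ⟩)
          (fun ν w => covD (torusT (F.P K) 0) (fun κ z => unitsField (toUField W) ⟨z, κ⟩) ν ψ w) z) y) x = 0)
    (Ψ : H → Site (F.P K) (K - n) → Site (F.P K) 0 → Matrix (Fin 2) (Fin 2) ℂ) (hΨ : ∀ η y, Ψ η y (embIter (K - n) y) = ψ (embIter (K - n) y))
    (Z : Fin (F.P K).d → Site (F.P K) 0 → Matrix (Fin 2) (Fin 2) ℂ) (G : Site (F.P K) (K - n) → ℝ)
    (hG : ∀ (y : Site (F.P K) (K - n)) (z : Site (F.P K) 0),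
      (∀ ν : Fin (F.P K).d,
        (y ν = (iterBlockOf (K - n) (fun κ => z κ - (((((F.P K).L ^ (K - n) - 1) / 2 : ℕ)) : ZMod ((F.P K).sitesPerDir 0)))) ν - 1
        ∨ y ν = (iterBlockOf (K - n) (fun κ => z κ - (((((F.P K).L ^ (K - n) - 1) / 2 : ℕ)) : ZMod ((F.P K).sitesPerDir 0)))) ν
        ∨ y ν = (iterBlockOf (K - n) (fun κ => z κ - (((((F.P K).L ^ (K - n) - 1) / 2 : ℕ)) : ZMod ((F.P K).sitesPerDir 0)))) ν + 1
        ∨ y ν = (iterBlockOf (K - n) (fun κ => z κ - (((((F.P K).L ^ (K - n) - 1) / 2 : ℕ)) : ZMod ((F.P K).sitesPerDir 0)))) ν + 2)) →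
      ∀ μ : Fin (F.P K).d, ‖(Fintype.card H : ℝ)⁻¹ • ∑ η, Ψ η y z - Z μ z‖ ≤ G y) :
    (F.L : ℝ) ^ (K - n) * ∑ x : Site (F.P K) 0, ∑ a : Fin 2, ∑ b : Fin 2,
        Complex.normSq ((divB (torusT (F.P K) 0) (fun κ z => unitsField (toUField W) ⟨z, κ⟩)
          (fun κ y => covD (torusT (F.P K) 0) (fun κ z => unitsField (toUField W) ⟨z, κ⟩) κ ψ y) x) a b)
      ≤ (F.L : ℝ) ^ (K - n) * (2 * (
          3 * ∑ y : Site (F.P K) (K - n), ∑ z : Site (F.P K) 0,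
            (if (∀ ν : Fin (F.P K).d,
                (y ν = (iterBlockOf (K - n) (fun κ => z κ - (((((F.P K).L ^ (K - n) - 1) / 2 : ℕ)) : ZMod ((F.P K).sitesPerDir 0)))) ν - 1
                ∨ y ν = (iterBlockOf (K - n) (fun κ => z κ - (((((F.P K).L ^ (K - n) - 1) / 2 : ℕ)) : ZMod ((F.P K).sitesPerDir 0)))) ν
                ∨ y ν = (iterBlockOf (K - n) (fun κ => z κ - (((((F.P K).L ^ (K - n) - 1) / 2 : ℕ)) : ZMod ((F.P K).sitesPerDir 0)))) ν + 1
                ∨ y ν = (iterBlockOf (K - n) (fun κ => z κ - (((((F.P K).L ^ (K - n) - 1) / 2 : ℕ)) : ZMod ((F.P K).sitesPerDir 0)))) ν + 2))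
              then (Fintype.card H : ℝ)⁻¹ * ∑ η, ‖divB (torusT (F.P K) 0) (fun κ z => unitsField (toUField W) ⟨z, κ⟩)
                (fun μ => covD (torusT (F.P K) 0) (fun κ z => unitsField (toUField W) ⟨z, κ⟩) μ (Ψ η y)) z‖ ^ 2 else 0)
          + 3 * (2 * ((F.P K).d : ℝ) * (6 / ((((F.P K).L ^ (K - n) : ℕ) : ℝ)))) * (3 / ((((F.P K).L ^ (K - n) : ℕ) : ℝ)))
            * ∑ y : Site (F.P K) (K - n), ∑ z : Site (F.P K) 0,
              (if (∀ ν : Fin (F.P K).d,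
                  (y ν = (iterBlockOf (K - n) (fun κ => z κ - (((((F.P K).L ^ (K - n) - 1) / 2 : ℕ)) : ZMod ((F.P K).sitesPerDir 0)))) ν - 1
                  ∨ y ν = (iterBlockOf (K - n) (fun κ => z κ - (((((F.P K).L ^ (K - n) - 1) / 2 : ℕ)) : ZMod ((F.P K).sitesPerDir 0)))) ν
                  ∨ y ν = (iterBlockOf (K - n) (fun κ => z κ - (((((F.P K).L ^ (K - n) - 1) / 2 : ℕ)) : ZMod ((F.P K).sitesPerDir 0)))) ν + 1
                  ∨ y ν = (iterBlockOf (K - n) (fun κ => z κ - (((((F.P K).L ^ (K - n) - 1) / 2 : ℕ)) : ZMod ((F.P K).sitesPerDir 0)))) ν + 2))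
                then ∑ μ : Fin (F.P K).d, (Fintype.card H : ℝ)⁻¹ * ∑ η,
                  (‖covDstar (torusT (F.P K) 0) (fun κ z => unitsField (toUField W) ⟨z, κ⟩) μ (Ψ η y) z‖ ^ 2
                    + ‖covD (torusT (F.P K) 0) (fun κ z => unitsField (toUField W) ⟨z, κ⟩) μ (Ψ η y) z‖ ^ 2) else 0)
          + 3 * ((F.P K).d : ℝ) ^ 2 * (24 / ((((F.P K).L ^ (K - n) : ℕ) : ℝ)) ^ 2)
            * (24 / ((((F.P K).L ^ (K - n) : ℕ) : ℝ)) ^ 2 * ((((F.P K).L ^ (K - n) : ℕ) : ℝ)) ^ (F.P K).d) * ∑ y : Site (F.P K) (K - n), G y ^ 2)) := by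
  have hc : (0 : ℝ) < Fintype.card H := by exact_mod_cast Fintype.card_pos
  have hΨbar : ∀ y : Site (F.P K) (K - n), (Fintype.card H : ℝ)⁻¹ • ∑ η, Ψ η y (embIter (K - n) y) = ψ (embIter (K - n) y) := by
    intro y
    rw [Finset.sum_congr rfl (fun η _ => hΨ η y), Finset.sum_const, Finset.card_univ, ← Nat.cast_smul_eq_nsmul ℝ, smul_smul,
      inv_mul_cancel₀ hc.ne', one_smul]
  have main := lemmaH_curved_of_localModels F K n hk hℓ2 W ψ hψ (fun y z => (Fintype.card H : ℝ)⁻¹ • ∑ η, Ψ η y z) hΨbar Z G hG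
  refine main.trans (mul_le_mul_of_nonneg_left (mul_le_mul_of_nonneg_left (add_le_add (add_le_add ?_ ?_) le_rfl) (by norm_num)) (by positivity))
  · -- Laplacian group: convexity per site
    refine mul_le_mul_of_nonneg_left (Finset.sum_le_sum fun y _ => Finset.sum_le_sum fun z _ => ?_) (by norm_num)
    split_ifs with hN
    · exact norm_sq_lap_avg_le (torusT (F.P K) 0) (fun κ z => unitsField (toUField W) ⟨z, κ⟩) (fun η => Ψ η y) z
    · exact le_rfl
  · -- Dirichlet group: convexity per bond
    refine mul_le_mul_of_nonneg_left (Finset.sum_le_sum fun y _ => Finset.sum_le_sum fun z _ => ?_) (by positivity)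
    split_ifs with hN
    · refine Finset.sum_le_sum fun μ _ => ?_
      have h1 := norm_sq_covDstar_avg_le (torusT (F.P K) 0) (fun κ z => unitsField (toUField W) ⟨z, κ⟩) (fun η => Ψ η y) μ z
      have h2 := norm_sq_covD_avg_le (torusT (F.P K) 0) (fun κ z => unitsField (toUField W) ⟨z, κ⟩) (fun η => Ψ η y) μ z
      refine (add_le_add h1 h2).trans (le_of_eq ?_)
      rw [← mul_add, ← Finset.sum_add_distrib]
    · exact le_rfl

end T3

/-! ## §3 The averaged AXIAL family (loop-commutator currency) -/

section Axial

variable {H : Type*} [Fintype H] [Nonempty H]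

/-- ★★★ **LEMMA-H-CURVED AT AN AVERAGED AXIAL FAMILY** (T³ letters): local models `Ψ^η_y(z) = R((axialT W c^η_y z)⁻¹) m^η_y` with bases `c^η_y` and data `m^η_y` interpolating `ψ` at
the centres (displayed), averaged over `η`; every slack term is an average over `η` of commutators `N_{m^η_y}(·)` with thin loops (Dirichlet group) ∕ double ladders (Laplacian
group) based at `c^η_y` — zero on aligned data. `H = Unit`, `c_y = embIter y`, `m_y = ψ(embIter y)` is ✓ `lemmaH_curved_comb`.
[cite: Balaban1985BackgroundPropagators, (3.3)-(3.4) pp.390-391, Thm 3.11 p.416; Balaban1985UV3, (27) p.263; Balaban1985Averaging, (9) p.19, p.24; Balaban1985Variational, Prop. 7 p.299] -/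
theorem lemmaH_curved_comb_avg (F : T3Family) (K n : ℕ) (hk : K - n ≤ (F.P K).m + (F.P K).K) (hℓ2 : 2 ≤ (F.P K).L ^ (K - n))
    (W : GaugeField (F.P K) 0 (Matrix.specialUnitaryGroup (Fin 2) ℂ)) (ψ : Site (F.P K) 0 → Matrix (Fin 2) (Fin 2) ℂ)
    (hψ : ∀ x : Site (F.P K) 0, x ∉ Set.range (embIter (K - n)) →
      divB (torusT (F.P K) 0) (fun κ z => unitsField (toUField W) ⟨z, κ⟩) (fun κ y => covD (torusT (F.P K) 0) (fun κ z => unitsField (toUField W) ⟨z, κ⟩) κ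
        (fun z => divB (torusT (F.P K) 0) (fun κ z => unitsField (toUField W) ⟨z, κ⟩)
          (fun ν w => covD (torusT (F.P K) 0) (fun κ z => unitsField (toUField W) ⟨z, κ⟩) ν ψ w) z) y) x = 0)
    (c : H → Site (F.P K) (K - n) → Site (F.P K) 0) (mdat : H → Site (F.P K) (K - n) → Matrix (Fin 2) (Fin 2) ℂ)
    (hinterp : ∀ η y, R (axialT (unitsField (toUField W)) (c η y) (embIter (K - n) y))⁻¹ (mdat η y) = ψ (embIter (K - n) y))
    (hwrap : ∀ (η : H) (y : Site (F.P K) (K - n)) (z : Site (F.P K) 0),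
      (∀ ν : Fin (F.P K).d,
        (y ν = (iterBlockOf (K - n) (fun κ => z κ - (((((F.P K).L ^ (K - n) - 1) / 2 : ℕ)) : ZMod ((F.P K).sitesPerDir 0)))) ν - 1
        ∨ y ν = (iterBlockOf (K - n) (fun κ => z κ - (((((F.P K).L ^ (K - n) - 1) / 2 : ℕ)) : ZMod ((F.P K).sitesPerDir 0)))) ν
        ∨ y ν = (iterBlockOf (K - n) (fun κ => z κ - (((((F.P K).L ^ (K - n) - 1) / 2 : ℕ)) : ZMod ((F.P K).sitesPerDir 0)))) ν + 1
        ∨ y ν = (iterBlockOf (K - n) (fun κ => z κ - (((((F.P K).L ^ (K - n) - 1) / 2 : ℕ)) : ZMod ((F.P K).sitesPerDir 0)))) ν + 2)) →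
      ∀ μ : Fin (F.P K).d, (rel (c η y) z μ + 1) * 2 ≤ ((F.P K).sitesPerDir 0 : ℤ)
        ∧ (rel (c η y) ((torusT (F.P K) 0 μ).symm z) μ + 1) * 2 ≤ ((F.P K).sitesPerDir 0 : ℤ))
    (Z : Fin (F.P K).d → Site (F.P K) 0 → Matrix (Fin 2) (Fin 2) ℂ) (G : Site (F.P K) (K - n) → ℝ)
    (hG : ∀ (y : Site (F.P K) (K - n)) (z : Site (F.P K) 0),
      (∀ ν : Fin (F.P K).d,
        (y ν = (iterBlockOf (K - n) (fun κ => z κ - (((((F.P K).L ^ (K - n) - 1) / 2 : ℕ)) : ZMod ((F.P K).sitesPerDir 0)))) ν - 1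
        ∨ y ν = (iterBlockOf (K - n) (fun κ => z κ - (((((F.P K).L ^ (K - n) - 1) / 2 : ℕ)) : ZMod ((F.P K).sitesPerDir 0)))) ν
        ∨ y ν = (iterBlockOf (K - n) (fun κ => z κ - (((((F.P K).L ^ (K - n) - 1) / 2 : ℕ)) : ZMod ((F.P K).sitesPerDir 0)))) ν + 1
        ∨ y ν = (iterBlockOf (K - n) (fun κ => z κ - (((((F.P K).L ^ (K - n) - 1) / 2 : ℕ)) : ZMod ((F.P K).sitesPerDir 0)))) ν + 2)) →
      ∀ μ : Fin (F.P K).d, ‖(Fintype.card H : ℝ)⁻¹ • ∑ η, R (axialT (unitsField (toUField W)) (c η y) z)⁻¹ (mdat η y) - Z μ z‖ ≤ G y) :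
    (F.L : ℝ) ^ (K - n) * ∑ x : Site (F.P K) 0, ∑ a : Fin 2, ∑ b : Fin 2,
        Complex.normSq ((divB (torusT (F.P K) 0) (fun κ z => unitsField (toUField W) ⟨z, κ⟩)
          (fun κ y => covD (torusT (F.P K) 0) (fun κ z => unitsField (toUField W) ⟨z, κ⟩) κ ψ y) x) a b)
      ≤ (F.L : ℝ) ^ (K - n) * (2 * (
          3 * ∑ y : Site (F.P K) (K - n), ∑ z : Site (F.P K) 0,
            (if (∀ ν : Fin (F.P K).d,
                (y ν = (iterBlockOf (K - n) (fun κ => z κ - (((((F.P K).L ^ (K - n) - 1) / 2 : ℕ)) : ZMod ((F.P K).sitesPerDir 0)))) ν - 1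
                ∨ y ν = (iterBlockOf (K - n) (fun κ => z κ - (((((F.P K).L ^ (K - n) - 1) / 2 : ℕ)) : ZMod ((F.P K).sitesPerDir 0)))) ν
                ∨ y ν = (iterBlockOf (K - n) (fun κ => z κ - (((((F.P K).L ^ (K - n) - 1) / 2 : ℕ)) : ZMod ((F.P K).sitesPerDir 0)))) ν + 1
                ∨ y ν = (iterBlockOf (K - n) (fun κ => z κ - (((((F.P K).L ^ (K - n) - 1) / 2 : ℕ)) : ZMod ((F.P K).sitesPerDir 0)))) ν + 2))
              then (Fintype.card H : ℝ)⁻¹ * ∑ η, (∑ μ : Fin (F.P K).d,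
                      (‖(((holT (unitsField (toUField W)) (c η y) (contourT (c η y) ⟨(torusT (F.P K) 0 μ).symm z, μ⟩))⁻¹
                            * holT (unitsField (toUField W)) (c η y) (contourT (c η y) ⟨z, μ⟩) : (Matrix (Fin 2) (Fin 2) ℂ)ˣ) : Matrix (Fin 2) (Fin 2) ℂ) * mdat η y
                        - mdat η y * (((holT (unitsField (toUField W)) (c η y) (contourT (c η y) ⟨(torusT (F.P K) 0 μ).symm z, μ⟩))⁻¹
                            * holT (unitsField (toUField W)) (c η y) (contourT (c η y) ⟨z, μ⟩) : (Matrix (Fin 2) (Fin 2) ℂ)ˣ) : Matrix (Fin 2) (Fin 2) ℂ)‖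
                        + 2 * ‖((holT (unitsField (toUField W)) (c η y) (contourT (c η y) ⟨(torusT (F.P K) 0 μ).symm z, μ⟩) :
                                (Matrix (Fin 2) (Fin 2) ℂ)ˣ) : Matrix (Fin 2) (Fin 2) ℂ) - 1‖
                          * ‖((holT (unitsField (toUField W)) (c η y) (contourT (c η y) ⟨(torusT (F.P K) 0 μ).symm z, μ⟩) :
                                (Matrix (Fin 2) (Fin 2) ℂ)ˣ) : Matrix (Fin 2) (Fin 2) ℂ) * mdat η y
                              - mdat η y * ((holT (unitsField (toUField W)) (c η y) (contourT (c η y) ⟨(torusT (F.P K) 0 μ).symm z, μ⟩) :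
                                (Matrix (Fin 2) (Fin 2) ℂ)ˣ) : Matrix (Fin 2) (Fin 2) ℂ)‖)) ^ 2
              else 0)
          + 3 * (2 * ((F.P K).d : ℝ) * (6 / ((((F.P K).L ^ (K - n) : ℕ) : ℝ)))) * (3 / ((((F.P K).L ^ (K - n) : ℕ) : ℝ)))
            * ∑ y : Site (F.P K) (K - n), ∑ z : Site (F.P K) 0,
              (if (∀ ν : Fin (F.P K).d,
                  (y ν = (iterBlockOf (K - n) (fun κ => z κ - (((((F.P K).L ^ (K - n) - 1) / 2 : ℕ)) : ZMod ((F.P K).sitesPerDir 0)))) ν - 1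
                  ∨ y ν = (iterBlockOf (K - n) (fun κ => z κ - (((((F.P K).L ^ (K - n) - 1) / 2 : ℕ)) : ZMod ((F.P K).sitesPerDir 0)))) ν
                  ∨ y ν = (iterBlockOf (K - n) (fun κ => z κ - (((((F.P K).L ^ (K - n) - 1) / 2 : ℕ)) : ZMod ((F.P K).sitesPerDir 0)))) ν + 1
                  ∨ y ν = (iterBlockOf (K - n) (fun κ => z κ - (((((F.P K).L ^ (K - n) - 1) / 2 : ℕ)) : ZMod ((F.P K).sitesPerDir 0)))) ν + 2))
                then ∑ μ : Fin (F.P K).d, (Fintype.card H : ℝ)⁻¹ * ∑ η,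
                  (‖((holT (unitsField (toUField W)) (c η y) (contourT (c η y) ⟨(torusT (F.P K) 0 μ).symm z, μ⟩) :
                        (Matrix (Fin 2) (Fin 2) ℂ)ˣ) : Matrix (Fin 2) (Fin 2) ℂ) * mdat η y
                      - mdat η y * ((holT (unitsField (toUField W)) (c η y) (contourT (c η y) ⟨(torusT (F.P K) 0 μ).symm z, μ⟩) :
                        (Matrix (Fin 2) (Fin 2) ℂ)ˣ) : Matrix (Fin 2) (Fin 2) ℂ)‖ ^ 2
                    + ‖((holT (unitsField (toUField W)) (c η y) (contourT (c η y) ⟨z, μ⟩) :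
                        (Matrix (Fin 2) (Fin 2) ℂ)ˣ) : Matrix (Fin 2) (Fin 2) ℂ) * mdat η y
                      - mdat η y * ((holT (unitsField (toUField W)) (c η y) (contourT (c η y) ⟨z, μ⟩) :
                        (Matrix (Fin 2) (Fin 2) ℂ)ˣ) : Matrix (Fin 2) (Fin 2) ℂ)‖ ^ 2) else 0)
          + 3 * ((F.P K).d : ℝ) ^ 2 * (24 / ((((F.P K).L ^ (K - n) : ℕ) : ℝ)) ^ 2)
            * (24 / ((((F.P K).L ^ (K - n) : ℕ) : ℝ)) ^ 2 * ((((F.P K).L ^ (K - n) : ℕ) : ℝ)) ^ (F.P K).d) * ∑ y : Site (F.P K) (K - n), G y ^ 2)) := by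
  have hc : (0 : ℝ) ≤ (Fintype.card H : ℝ)⁻¹ := by positivity
  have hV : ∀ b : PBond (F.P K) 0, ‖((unitsField (toUField W) b : (Matrix (Fin 2) (Fin 2) ℂ)ˣ) : Matrix (Fin 2) (Fin 2) ℂ)‖ ≤ 1
      ∧ ‖(((unitsField (toUField W) b)⁻¹ : (Matrix (Fin 2) (Fin 2) ℂ)ˣ) : Matrix (Fin 2) (Fin 2) ℂ)‖ ≤ 1 :=
    fun b => bicontr_of_mem_unitary _ (unitsField_toUField_mem_unitary W b.dir b.src)
  have main := lemmaH_curved_of_localModels_avg F K n hk hℓ2 W ψ hψ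
    (fun η y z => R (axialT (unitsField (toUField W)) (c η y) z)⁻¹ (mdat η y)) hinterp Z G hG
  refine main.trans (mul_le_mul_of_nonneg_left (mul_le_mul_of_nonneg_left (add_le_add (add_le_add ?_ ?_) le_rfl) (by norm_num)) (by positivity))
  · refine mul_le_mul_of_nonneg_left (Finset.sum_le_sum fun y _ => Finset.sum_le_sum fun z _ => ?_) (by norm_num)
    split_ifs with hN
    · refine mul_le_mul_of_nonneg_left (Finset.sum_le_sum fun η _ => ?_) hc
      exact pow_le_pow_left₀ (norm_nonneg _) (norm_lap_axialModel_le (unitsField (toUField W)) hV (c η y) (mdat η y) z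
        (fun μ => (hwrap η y z hN μ).1) (fun μ => (hwrap η y z hN μ).2)) 2
    · exact le_rfl
  · refine mul_le_mul_of_nonneg_left (Finset.sum_le_sum fun y _ => Finset.sum_le_sum fun z _ => ?_) (by positivity)
    split_ifs with hN
    · refine Finset.sum_le_sum fun μ _ => mul_le_mul_of_nonneg_left (Finset.sum_le_sum fun η _ => add_le_add ?_ ?_) hc
      · exact pow_le_pow_left₀ (norm_nonneg _) (norm_covDstar_axialModel_le (unitsField (toUField W)) hV (c η y) (mdat η y) μ z (hwrap η y z hN μ).2) 2
      · exact pow_le_pow_left₀ (norm_nonneg _) (norm_covD_axialModel_le (unitsField (toUField W)) hV (c η y) (mdat η y) μ z (hwrap η y z hN μ).1) 2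
    · exact le_rfl

end Axial

end Summit.QuantumFields.YangMills.Theorems.Prop7LocalModelAverage

end
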